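import Summits.Ventures.PercRepro.RankLevelSetLevelSevenT11Cell8
import Summits.Ventures.PercRepro.RankLevelSetLevelSevenT11Cell9
import Summits.Ventures.PercRepro.RankLevelSetLevelSevenT11Cell10
import Summits.Ventures.PercRepro.RankLevelSetLevelSevenT11Cell11
import Summits.Ventures.PercRepro.RankLevelSetLevelSevenT11Cell12
import Summits.Ventures.PercRepro.RankLevelSetLevelSevenT11Cell13
import Summits.Ventures.PercRepro.RankLevelSetLevelSevenT11Cell14
import Summits.Ventures.PercRepro.RankLevelSetLevelSevenT11Cell15
import Summits.Ventures.PercRepro.RankLevelSetLevelSevenT11Cell16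
import Summits.Ventures.PercRepro.RankLevelSetLevelSevenT11Cell17
import Summits.Ventures.PercRepro.RankLevelSetLevelSevenT11Cell18
import Summits.Ventures.PercRepro.RankLevelSetLevelSevenT11Cell19
import Summits.Ventures.PercRepro.RankLevelSetLevelSevenT11Cell20
import Summits.Ventures.PercRepro.RankLevelSetLevelSevenT11Cell21
import Summits.Ventures.PercRepro.RankLevelSetLevelSevenT11Cell22
import Summits.Ventures.PercRepro.RankLevelSetLevelSevenT11Cell23
import Summits.Ventures.PercRepro.RankLevelSetLevelSevenT11Cell24
import Summits.Ventures.PercRepro.RankLevelSetLevelSevenT11Cell25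
import Summits.Ventures.PercRepro.RankLevelSetLevelSevenT11Cell26
import Summits.Ventures.PercRepro.RankLevelSetLevelSevenT11Cell27
import Summits.Ventures.PercRepro.RankLevelSetLevelSevenT11Cell28
import Summits.Ventures.PercRepro.RankLevelSetLevelSevenT11Cell29
import Summits.Ventures.PercRepro.RankLevelSetLevelSevenT11Cell30
import Summits.Ventures.PercRepro.RankLevelSetLevelSevenT11Cell31
import Summits.Ventures.PercRepro.RankLevelSetLevelSevenT11Cell32
import Summits.Ventures.PercRepro.RankLevelSetLevelSevenT11Cell33
import Summits.Ventures.PercRepro.RankLevelSetLevelSevenT11Cell34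
import Summits.Ventures.PercRepro.RankLevelSetLevelSevenT11Cell35
import Summits.Ventures.PercRepro.RankLevelSetLevelSevenT11Cell36
import Summits.Ventures.PercRepro.RankLevelSetLevelSevenT11Cell37
import Summits.Ventures.PercRepro.RankLevelSetLevelSevenT11Cell38
import Summits.Ventures.PercRepro.RankLevelSetLevelSevenT11Cell39
import Summits.Ventures.PercRepro.RankLevelSetLevelSevenT11Cell40
import Summits.Ventures.PercRepro.RankLevelSetLevelSevenT11Cell41
import Summits.Ventures.PercRepro.RankLevelSetLevelSevenT11Cell42
import Summits.Ventures.PercRepro.RankLevelSetLevelSevenT11Cell43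
import Summits.Ventures.PercRepro.RankLevelSetLevelSevenT11Cell44
import Summits.Ventures.PercRepro.RankLevelSetLevelSevenT11Cell45
import Summits.Ventures.PercRepro.RankLevelSetLevelSevenT11Cell46
import Summits.Ventures.PercRepro.RankLevelSetLevelSevenT11Cell47
import Summits.Ventures.PercRepro.RankLevelSetLevelSevenT11Cell48
import Summits.Ventures.PercRepro.RankLevelSetLevelSevenT11Cell49
import Summits.Ventures.PercRepro.RankLevelSetLevelSevenT11Cell50
import Summits.Ventures.PercRepro.RankLevelSetLevelSevenT11Cell51
import Summits.Ventures.PercRepro.RankLevelSetLevelSevenT11Cell52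
import Summits.Ventures.PercRepro.RankLevelSetLevelSevenT11Cell53
import Summits.Ventures.PercRepro.RankLevelSetLevelSevenT11Cell54
import Summits.Ventures.PercRepro.RankLevelSetLevelSevenT11Cell55
import Summits.Ventures.PercRepro.RankLevelSetLevelSevenT11Cell56
import Summits.Ventures.PercRepro.RankLevelSetLevelSevenT11Cell57
import Summits.Ventures.PercRepro.RankLevelSetLevelSevenT11Cell58
import Summits.Ventures.PercRepro.RankLevelSetLevelSevenT11Cell59
import Summits.Ventures.PercRepro.RankLevelSetLevelSevenT11Cell60
import Summits.Ventures.PercRepro.RankLevelSetLevelSevenT11Cell61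
import Summits.Ventures.PercRepro.RankLevelSetLevelSevenT11Cell62
import Summits.Ventures.PercRepro.RankLevelSetLevelSevenT11Cell63
import Summits.Ventures.PercRepro.RankLevelSetLevelSevenT11Cell64
import Summits.Ventures.PercRepro.RankLevelSetLevelSevenT11Cell65
import Summits.Ventures.PercRepro.RankLevelSetLevelSevenT11Cell66
import Summits.Ventures.PercRepro.RankLevelSetLevelSevenT11Cell67
import Summits.Ventures.PercRepro.RankLevelSetLevelSevenT11Cell68
import Summits.Ventures.PercRepro.RankLevelSetLevelSevenT11Cell69
import Summits.Ventures.PercRepro.RankLevelSetLevelSevenT11Cell70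
import Summits.Ventures.PercRepro.RankLevelSetLevelSevenT11Cell71
import Summits.Ventures.PercRepro.RankLevelSetLevelSevenT11Cell72
import Summits.Ventures.PercRepro.RankLevelSetLevelSevenT11Cell73
import Summits.Ventures.PercRepro.RankLevelSetLevelSevenT11Cell74
import Summits.Ventures.PercRepro.S4MidKeyEleven
import Summits.Ventures.PercRepro.S4SevenWindow
import Summits.Ventures.PercRepro.RankLevelSetLevelSixRowsNineToFifteen

/-!
# PercRepro — THE 11 ROW OF LEVEL `7`: `c025_core_seven_eleven (d ≥ 8) : RLS M 11 7` ON EVERY `e`-FREE CORE OF RANK `11`, AND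
**THEOREM C₇ AT RANK `11`** (p7 g23, S4 feeder; p8's assembly shape — NO window claim, p9 owns S4)

The core cells `(11, d)`: `8 ≤ d ≤ 74` by the coloop device with the lossy ladder (`c025_core_seven_eleven_<d>`: `k = 0` the LP cell `(11, d)` with the
upward rows by core size, `k ≥ 1` the natural cells of the rows `11 − k` at the same corank at `κ_k`, the rest retired), `d ≥ 75` by p1's middle key
(`S4Mid.c025_core_seven_midkey_eleven`, no coloop-freeness needed). Then the level-6 glue `rls_seven_at_of_core 11` on `c025_six_all` (level `6` at `p = 10`)
gives level `7` at `p = 11`: **`c025_seven_at_eleven : RLS M 11 7`** for every finite matroid.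
Axioms: standard.
-/

open scoped Matroid

namespace PercRepro

namespace ThmN

variable {α : Type}

/-- **The core cell `(11, d)` at every corank `d ≥ 8`, every `e`-free core.** -/
theorem c025_core_seven_eleven (M : Matroid α) [M.Finite] (d : ℕ) (hd8 : 8 ≤ d)
    (hR : M.eRank = (11 : ℕ∞)) (hn : M.E.ncard = 11 + d)
    (hfree : ∀ e ∈ M.E, ∃ A ⊆ M.E \ {e}, e ∉ M.closure A ∧ e ∉ M.closure ((M.E \ {e}) \ A)) :
    RLS M 11 7 := by
  rcases Nat.lt_or_ge d 75 with hlt | hge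
  · interval_cases d
    · exact c025_core_seven_eleven_8 M hR hn hfree
    · exact c025_core_seven_eleven_9 M hR hn hfree
    · exact c025_core_seven_eleven_10 M hR hn hfree
    · exact c025_core_seven_eleven_11 M hR hn hfree
    · exact c025_core_seven_eleven_12 M hR hn hfree
    · exact c025_core_seven_eleven_13 M hR hn hfree
    · exact c025_core_seven_eleven_14 M hR hn hfree
    · exact c025_core_seven_eleven_15 M hR hn hfree
    · exact c025_core_seven_eleven_16 M hR hn hfree
    · exact c025_core_seven_eleven_17 M hR hn hfree
    · exact c025_core_seven_eleven_18 M hR hn hfree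
    · exact c025_core_seven_eleven_19 M hR hn hfree
    · exact c025_core_seven_eleven_20 M hR hn hfree
    · exact c025_core_seven_eleven_21 M hR hn hfree
    · exact c025_core_seven_eleven_22 M hR hn hfree
    · exact c025_core_seven_eleven_23 M hR hn hfree
    · exact c025_core_seven_eleven_24 M hR hn hfree
    · exact c025_core_seven_eleven_25 M hR hn hfree
    · exact c025_core_seven_eleven_26 M hR hn hfree
    · exact c025_core_seven_eleven_27 M hR hn hfree
    · exact c025_core_seven_eleven_28 M hR hn hfree
    · exact c025_core_seven_eleven_29 M hR hn hfree
    · exact c025_core_seven_eleven_30 M hR hn hfree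
    · exact c025_core_seven_eleven_31 M hR hn hfree
    · exact c025_core_seven_eleven_32 M hR hn hfree
    · exact c025_core_seven_eleven_33 M hR hn hfree
    · exact c025_core_seven_eleven_34 M hR hn hfree
    · exact c025_core_seven_eleven_35 M hR hn hfree
    · exact c025_core_seven_eleven_36 M hR hn hfree
    · exact c025_core_seven_eleven_37 M hR hn hfree
    · exact c025_core_seven_eleven_38 M hR hn hfree
    · exact c025_core_seven_eleven_39 M hR hn hfree
    · exact c025_core_seven_eleven_40 M hR hn hfree
    · exact c025_core_seven_eleven_41 M hR hn hfree
    · exact c025_core_seven_eleven_42 M hR hn hfree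
    · exact c025_core_seven_eleven_43 M hR hn hfree
    · exact c025_core_seven_eleven_44 M hR hn hfree
    · exact c025_core_seven_eleven_45 M hR hn hfree
    · exact c025_core_seven_eleven_46 M hR hn hfree
    · exact c025_core_seven_eleven_47 M hR hn hfree
    · exact c025_core_seven_eleven_48 M hR hn hfree
    · exact c025_core_seven_eleven_49 M hR hn hfree
    · exact c025_core_seven_eleven_50 M hR hn hfree
    · exact c025_core_seven_eleven_51 M hR hn hfree
    · exact c025_core_seven_eleven_52 M hR hn hfree
    · exact c025_core_seven_eleven_53 M hR hn hfree
    · exact c025_core_seven_eleven_54 M hR hn hfree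
    · exact c025_core_seven_eleven_55 M hR hn hfree
    · exact c025_core_seven_eleven_56 M hR hn hfree
    · exact c025_core_seven_eleven_57 M hR hn hfree
    · exact c025_core_seven_eleven_58 M hR hn hfree
    · exact c025_core_seven_eleven_59 M hR hn hfree
    · exact c025_core_seven_eleven_60 M hR hn hfree
    · exact c025_core_seven_eleven_61 M hR hn hfree
    · exact c025_core_seven_eleven_62 M hR hn hfree
    · exact c025_core_seven_eleven_63 M hR hn hfree
    · exact c025_core_seven_eleven_64 M hR hn hfree
    · exact c025_core_seven_eleven_65 M hR hn hfree
    · exact c025_core_seven_eleven_66 M hR hn hfree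
    · exact c025_core_seven_eleven_67 M hR hn hfree
    · exact c025_core_seven_eleven_68 M hR hn hfree
    · exact c025_core_seven_eleven_69 M hR hn hfree
    · exact c025_core_seven_eleven_70 M hR hn hfree
    · exact c025_core_seven_eleven_71 M hR hn hfree
    · exact c025_core_seven_eleven_72 M hR hn hfree
    · exact c025_core_seven_eleven_73 M hR hn hfree
    · exact c025_core_seven_eleven_74 M hR hn hfree
  · exact S4Mid.c025_core_seven_midkey_eleven M (by omega) hfree

/-- **THEOREM C₇ AT RANK `11`**: level `7` at `p = 11` for every finite matroid (on level `6` at `p = 10`, `c025_six_all`). -/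
theorem c025_seven_at_eleven (M : Matroid α) [M.Finite] : RLS M 11 7 :=
  rls_seven_at_of_core 11 (by norm_num) (fun M _ => c025_six_all M 10 (by norm_num))
    (fun M _ d hd hR hn hfree => c025_core_seven_eleven M d hd hR hn hfree) M

end ThmN

end PercRepro
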